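import Summits.Ventures.DiscreteObjects.PP12.FlagTenOrbitDataOfPlane
import Summits.Ventures.DiscreteObjects.PP12.OrbitSideIdentities

/-!
# The `f = 10` flag-cell orbit data: `γ` separates a triangle from the triangle it is inscribed in (kernel; Step C, conjunct 2 second half)
Framing: lottery ticket; floor = certified bounds/negative ranges.

Cell pub-namedobj (venture DiscreteObjects), target (M), designs gen 13 (HOME FAMILY-FLAG7X §7/§7b). Setting as in `FlagTenOrbitDataOfPlane`.
* `lpoints_eq_orb3` — the three non-fixed points of `l` form one orbit (dual of `FlagTenShape.clines_eq_orb3`);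
* **`gammaOrb_phiVertex_ne`** — for every fixed line `m ≠ l`, `gammaOrb m (phiVertex x) ≠ gammaOrb m x`: the first USE of the plane-level (R1)
  identity `OrbitSideIdentities.side_side_identity` inside the reduction — applied to the side `x·σx` and the foreign side of `x`, whose own-triangle
  term is ≥ 1 and whose Z-point term is ≥ 1, so every T-point term vanishes.
Together with `FlagTenFibres.card_gammaOrb_fibre` this is conjunct 2 (`IsTriangleColouring φ (γ j)`) of `IsFlagTenOrbitMatrix` before transport.
No `sorry`, no new axioms.
-/

namespace Summit.Ventures.DiscreteObjects.PP12

open Configuration Finset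
open scoped Classical

namespace Collineation

variable {P L : Type*} [Membership P L] [ProjectivePlane P L] [Fintype P] [Fintype L] (σ : Collineation P L)

section Flag

variable {l : L} {c : P} (hl : σ.onLines l = l) (hc : σ.onPoints c = c) (hcl : c ∈ l)
  (hP : ∀ p : P, σ.onPoints p = p → p ∈ l) (hL : ∀ m : L, σ.onLines m = m → c ∈ m)
  (h12 : ProjectivePlane.order P L = 12)

/-! ### Adjacent triangles are separated by `γ` (conjunct 2, second half) -/

include hl hP h12 in
/-- The non-fixed points of `l` form ONE orbit (`f = 10`; dual of `FlagTenShape.clines_eq_orb3`). -/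
theorem lpoints_eq_orb3 (hq : σ.onPoints ^ 3 = 1) (hf : fixedCard σ.onPoints = 10) {z : P} (hzl : z ∈ l) (hz : σ.onPoints z ≠ z)
    {z' : P} (hz'l : z' ∈ l) (hz' : σ.onPoints z' ≠ z') : z' ∈ orb3 σ.onPoints z := by
  have hqL : σ.onLines ^ 3 = 1 := σ.onLines_pow_eq_one hq
  have h12' : ProjectivePlane.order (Dual L) (Dual P) = 12 := by rw [ProjectivePlane.Dual.order]; exact h12
  have hf' : fixedCard σ.dual.onPoints = 10 := by
    change fixedCard σ.onLines = 10; rw [← σ.fixedCard_points_eq_lines]; exact hf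
  have hq' : σ.dual.onPoints ^ 3 = 1 := hqL
  exact σ.dual.clines_eq_orb3 (c := (l : Dual L)) hl hP h12' hq' hf' (u₀ := (z : Dual P)) hzl hz (u := (z' : Dual P)) hz'l hz'

include hl hc hcl hP hL h12 in
/-- **`γ` separates a triangle from the triangle it is inscribed in** (`f = 10`): for a fixed line `m ≠ l`, the side orbits of the triangle of
`x` and of the triangle of `phiVertex x` meet `m` in DIFFERENT orbits. With `card_gammaOrb_fibre` this is conjunct 2 of `IsFlagTenOrbitMatrix`
(`IsTriangleColouring`) before transport. Proof: `side_side_identity` for the side `x·σx` against the foreign side of `x`. -/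
theorem gammaOrb_phiVertex_ne (hq : σ.onPoints ^ 3 = 1) (hf : fixedCard σ.onPoints = 10) {u₀ : L} (hcu₀ : c ∈ u₀) (hu₀ : σ.onLines u₀ ≠ u₀)
    {x : P} (hxu : x ∈ u₀) (hxc : x ≠ c) {m : L} (hm : σ.onLines m = m) (hml : m ≠ l) :
    σ.gammaOrb l c m (σ.phiVertex l c u₀ x) ≠ σ.gammaOrb l c m x := by
  intro hγ
  have hxX := σ.exterior_of_mem_cline hL hcu₀ hu₀ hxu hxc
  have hxf : σ.onPoints x ≠ x := σ.not_fixed_of_exterior_flag hl hP hxX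
  obtain ⟨hxa, hσxa⟩ := σ.sideOf_spec l hxf
  set a := σ.sideOf l x with ha_def
  obtain ⟨hna, ha0⟩ := σ.side_no_fixed_point hxf hxX hxa hσxa
  obtain ⟨hx'u, hx'c, ⟨Q, hQx', hQF, hσQF⟩, hne⟩ := σ.phiVertex_spec hl hc hcl hP hL h12 hq hf hcu₀ hu₀ hxX
  set x' := σ.phiVertex l c u₀ x with hx'_def
  obtain ⟨hxF, hF0, -, -⟩ := σ.foreignSide_spec hl hP h12 hq hf hxX
  set F := σ.foreignSide l x with hF_def
  have hx'X := σ.exterior_of_mem_cline hL hcu₀ hu₀ hx'u hx'c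
  have hQX : ∀ m' : L, σ.onLines m' = m' → Q ∉ m' := σ.exterior_of_mem_orb3 hx'X hQx'
  have hQf : σ.onPoints Q ≠ Q := σ.not_fixed_of_exterior_flag hl hP hQX
  have hnF : σ.onLines F ≠ F := fun e => hF0 c hc (e ▸ hL F e)
  have horbQ : orb3 σ.onPoints Q = orb3 σ.onPoints x' := orb3_eq_of_mem σ.onPoints hq hQx'
  have hxQ : orb3 σ.onPoints x ≠ orb3 σ.onPoints Q := by rw [horbQ]; exact fun e => hne e.symm
  -- the (R1) identity for a = x·σx against the foreign side F (a side of the triangle of Q)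
  have hid := σ.side_side_identity hq hxf hQf hxQ hna hxa hσxa (fun q hq' hqf => ha0 q hqf hq') hnF hQF hσQF
  -- first term ≥ 1: x itself lies on F
  have hA : 1 ≤ ((orb3 σ.onPoints x).filter fun q' => q' ∈ F).card := card_pos.2 ⟨x, mem_filter.2 ⟨self_mem_orb3 _ _, hxF⟩⟩
  -- the Z-point z = a ∩ l belongs to the third set
  have hal : a ≠ l := fun e => ha0 c hc (e ▸ hcl)
  have hFl : F ≠ l := fun e => hF0 c hc (e ▸ hcl)
  obtain ⟨hza, hzl⟩ := meetPt_spec c hal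
  obtain ⟨hzFF, hzFl⟩ := meetPt_spec c hFl
  set z := meetPt c a l with hz_def
  set zF := meetPt c F l with hzF_def
  have hzf : σ.onPoints z ≠ z := fun e => ha0 z e hza
  have hzFf : σ.onPoints zF ≠ zF := fun e => hF0 zF e hzFF
  have hzFo : zF ∈ orb3 σ.onPoints z := σ.lpoints_eq_orb3 hl hP h12 hq hf hzl hzf hzFl hzFf
  -- exterior orbits avoid l and m; T-points / Z-points are not in them
  have notin_ext : ∀ {p : P} {k : L}, σ.onLines k = k → p ∈ k → ∀ {E : P}, (∀ m' : L, σ.onLines m' = m' → E ∉ m') →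
      p ∉ orb3 σ.onPoints E := by
    intro p k hk hpk E hEX hp
    exact (σ.exterior_of_mem_orb3 hEX hp) k hk hpk
  set R : Finset P := univ.filter fun q : P => q ∈ a ∧ q ∉ orb3 σ.onPoints x ∧ q ∉ orb3 σ.onPoints Q ∧
      ∃ q' ∈ orb3 σ.onPoints q, q' ∈ F with hR_def
  have hzR : z ∈ R := by
    rw [hR_def, mem_filter]
    exact ⟨mem_univ _, hza, notin_ext hl hzl hxX, notin_ext hl hzl hQX, zF, hzFo, hzFF⟩
  have hR1 : 1 ≤ R.card := card_pos.2 ⟨z, hzR⟩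
  -- hence A = 1, the middle term is 0 and R = {z}
  have hRle : R.card ≤ 1 := by omega
  have hReq : R = {z} := Finset.eq_singleton_iff_unique_mem.2 ⟨hzR, fun q hq' => Finset.card_le_one.1 hRle q hq' z hzR⟩
  -- the T-point w = a ∩ m also belongs to R if the two γ-orbits agree: contradiction (w ≠ z)
  have ham : a ≠ m := fun e => ha0 c hc (e ▸ hL m hm)
  obtain ⟨hwa, hwm⟩ := meetPt_spec c ham
  set w := meetPt c a m with hw_def
  -- F lies in the side orbit of x' and meets m inside gammaOrb m x' = gammaOrb m x = orb3 w
  have hx'f : σ.onPoints x' ≠ x' := σ.not_fixed_of_exterior_flag hl hP hx'X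
  obtain ⟨hx'a', hσx'a'⟩ := σ.sideOf_spec l hx'f
  have hFo : F ∈ orb3 σ.onLines (σ.sideOf l x') := by
    have h3 := apply_three σ.onPoints hq x'
    have hQσQ : Q ≠ σ.onPoints Q := fun e => hQf e.symm
    -- F is the line through Q and σQ; compare with the images of the side x'·σx'
    have uniq : ∀ k : L, Q ∈ k → σ.onPoints Q ∈ k → F = k := fun k h1 h2 =>
      (Nondegenerate.eq_or_eq hQF hσQF h1 h2).resolve_left hQσQ
    rw [mem_orb3] at hQx' ⊢
    rcases hQx' with e | e | e
    · left; apply uniq <;> rw [e]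
      · exact hx'a'
      · exact hσx'a'
    · right; left; apply uniq <;> rw [e]
      · exact σ.mem_map hx'a'
      · exact σ.mem_map hσx'a'
    · right; right; apply uniq <;> rw [e]
      · exact σ.mem_map (σ.mem_map hx'a')
      · exact σ.mem_map (σ.mem_map hσx'a')
  have hcx' : c ∉ σ.sideOf l x' := fun h => (σ.side_no_fixed_point hx'f hx'X hx'a' hσx'a').2 c hc h
  have hγ' : σ.gammaOrb l c m x' = orb3 σ.onPoints (meetPt c F m) := by
    change orb3 σ.onPoints (meetPt c (σ.sideOf l x') m) = _
    have h1 := σ.betaOrb_eq hc hL hq hm hcx' hFo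
    rw [σ.betaOrb_eq hc hL hq hm hcx' (self_mem_orb3 _ _)] at h1
    exact h1
  have hFm : F ≠ m := fun e => hF0 c hc (e ▸ hL m hm)
  obtain ⟨hwFF, hwFm⟩ := meetPt_spec c hFm
  have hwo : meetPt c F m ∈ orb3 σ.onPoints w := by
    have : orb3 σ.onPoints w = orb3 σ.onPoints (meetPt c F m) := by
      change σ.gammaOrb l c m x = _ ; rw [← hγ]; exact hγ'
    rw [this]; exact self_mem_orb3 _ _
  have hwR : w ∈ R := by
    rw [hR_def, mem_filter]
    exact ⟨mem_univ _, hwa, notin_ext hm hwm hxX, notin_ext hm hwm hQX, _, hwo, hwFF⟩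
  rw [hReq, mem_singleton] at hwR
  -- w = z lies on m and l, hence is c — but it is not fixed
  have hwc : w = c := (Nondegenerate.eq_or_eq hwm (hL m hm) (hwR ▸ hzl) hcl).resolve_right hml
  exact ha0 w (by rw [hwc, hc]) hwa


end Flag

end Collineation

end Summit.Ventures.DiscreteObjects.PP12
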